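import Mathlib.Data.ZMod.Basic
import Mathlib.RingTheory.Coprime.Lemmas
import Mathlib.Tactic
import HarnessLib

/-!
# Abelian selection rules on the two-gate toy chain: parity kills nothing, every rule is a `ℤ/3`- or `ℤ/5`-grading

HONEST FRAMING (cell `pub-fluidc`, library seat GADGETS, gen 56; verbatim): *low prior, high
value-of-information experiment on Tao's machine paradigm; NOT a claim that NS blows up.* Pure algebra about
the monomial table of the explicit 9-dimensional quadratic field `ChainField.F` (blueprint seat bp3); nothing
here is about the Navier–Stokes equations.

MODEL. Toy mode `i` (`0 … 8 = a₁ b₁ c₁ d₁ a₂ b₂ c₂ d₂ e₂`, the indexing of `ChainField.F`) realised as a REAL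
field on a pair of wavevector classes `{c i, -c i}` of an abelian class group (sublattice residues, `±1`
characters of order-two isometries, products — the exact selection rules of the cell's symmetric families, cf.
`SublatticeSupport`, `ForcedModes`, `DihedralSector`; dynamically a fixed-point subspace of an equivariant
field is flow-invariant [cite: GolubitskyStewart2002, Thm 1.17]) couples `xᵢ xⱼ → x_l` only if
`0 ∈ {± c i ± c j ± c l}`: ONE `Bool` test per unordered triad, `allowed (c i) (c j) (c l)` (a NECESSARY
condition for a coupling, not a sufficient one). `admissible c`: the 12 DESIGNED triads (the monomials of `F`:
`a₁b₁, a₁c₁, c₁², c₁d₁ → a₁`; `a₁², c₁² → b₁`; `a₁², b₁c₁, a₁c₁ → c₁`; `a₁c₁, d₁a₂ → d₁`; the same at gate 2;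
`d₁² → a₂`, `d₂² → e₂`; the list `designed`) are allowed; `killed c`: the undesigned triads (144 of the 156 in
`triads`; bp2's `harm_k53d` universe) whose test fails. The class group is the additive group of a commutative
ring `R` with decidable equality (every finite abelian group is one), so `linear_combination` does the algebra;
no proposition is defined here. PROVED (GADGETS record `code/gadgets/tests/selection_rules_k53d.md` §2–§4, §7;
`code/gadgets/MECHANISMS.md` §J): STRUCTURE LEMMA `three_or_five` / `span_all` (admissibility forces
`3·(c a₁) = 0 ∨ 5·(c a₁) = 0` and puts all nine classes in the cyclic group of `c a₁`); `kills_nothing`,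
`zmod_kills_nothing`, `parity_kills_nothing` (if some `n` coprime to 15 vanishes in `R` — parities and any
product of `ℤ/2`'s, `ℤ/4` / `ℤ/8` screw phases, `ℤ/7`, … — every admissible assignment is trivial: the
designed SQUARES force every mode into the even class; NO triad is killed); TRANSFER `grading` (a non-trivial
admissible assignment over ANY class ring kills exactly what some `ZMod 3` or `ZMod 5` assignment normalised
to `c' a₁ = 1` kills, with the same neutral classes — so facts `decide`d on `ZMod 3` / `ZMod 5` hold for every
abelian rule); witnesses by `decide +kernel` (`z5opt_killed`: an admissible `ℤ/5` assignment kills 78 of 144,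
the record's maximum over all abelian rules — the maximality is the tool's enumeration, not typed;
`z3cross_killed_iff`: 'gate 1 off the sublattice, gate 2 on it' kills 60, exactly the undesigned triads with one
gate-1 member; `z5ladder_killed`: a ladder-reusable assignment kills 68); bp3's measured priority list (STATUS
l.1805), over ANY class ring: `gate_binders_killed` (P0 `{a₁,b₁,c₁}`, P1 `{b₁,b₁,c₁}`, P2 `{a₁,b₁,b₁}` die
under every admissible assignment whose carrier class is not 3-torsion; `gate_binder_allowed_z3`: no `ℤ/3`
rule kills P0), `handover_killed_iff` (the hand-over leak `{a₁,a₂,c₂}` dies iff gate 2 is neutral),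
`immortal` (`{a₁,a₁,b₂}`, `{c₁,c₁,b₂}`, `{d₁,d₁,b₂}` pass every admissible assignment: '3 immortal of 144').
NOT claimed: anything about non-abelian (multi-dimensional irrep) rules, helicity, approximate suppression.
0 sorry, 0 named facts, no `Prop` definitions (D-0026/D-0027); `decide` / `decide +kernel` only (no
`native_decide`). [cite: Tao2016AveragedNS, §5.5 (5.5)]
-/

namespace Summit.NavierStokesRegularity.FluidComputer.ChainSelectionRules

section Ring

variable {R : Type*} [CommRing R] [DecidableEq R]

/-- The selection test of one unordered triad: a real field on classes `{±x}`, `{±y}`, `{±z}` can couple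
`x y → z` (or any permutation) only if `0 ∈ {±x ± y ± z}`. [folklore] -/
def allowed (x y z : R) : Bool :=
  decide (x + y + z = 0) || decide (x + y = z) || decide (x + z = y) || decide (y + z = x)

/-- `allowed` unfolded. [folklore] -/
theorem allowed_iff (x y z : R) :
    allowed x y z = true ↔ x + y + z = 0 ∨ x + y = z ∨ x + z = y ∨ y + z = x := by
  simp only [allowed, Bool.or_eq_true, decide_eq_true_eq, or_assoc]

/-- The neutral triad is always allowed. [folklore] -/
theorem allowed_zero : allowed (0 : R) 0 0 = true := (allowed_iff 0 0 0).mpr (Or.inl (by simp))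

/-- The 12 DESIGNED triads of `ChainField.F` as unordered index triples `(i ≤ j ≤ l)` on
`0 … 8 = a₁ b₁ c₁ d₁ a₂ b₂ c₂ d₂ e₂`: gate 1 `{a,a,b} {a,a,c} {a,c,c} {b,c,c} {a,c,d}`, handshake `{d₁,d₁,a₂}`,
gate 2 likewise, output `{d₂,d₂,e₂}`. [cite: Tao2016AveragedNS, §5.5 (5.5)] -/
def designed : List (Fin 9 × Fin 9 × Fin 9) :=
  [(0, 0, 1), (0, 0, 2), (0, 2, 2), (1, 2, 2), (0, 2, 3), (3, 3, 4),
   (4, 4, 5), (4, 4, 6), (4, 6, 6), (5, 6, 6), (4, 6, 7), (7, 7, 8)]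

/-- The ADMISSIBILITY test: every designed coupling is allowed (else the symmetric family does not realise
the chain at all). [folklore] -/
def admissible (c : Fin 9 → R) : Bool := designed.all fun t => allowed (c t.1) (c t.2.1) (c t.2.2)

/-- `admissible` unfolded. [folklore] -/
theorem admissible_iff (c : Fin 9 → R) :
    admissible c = true ↔ ∀ t ∈ designed, allowed (c t.1) (c t.2.1) (c t.2.2) = true := by
  simp only [admissible, List.all_eq_true]

/-- An allowed triad with two members in the cyclic group generated by `a` has its third member there. [folklore] -/
theorem span_third {a x y z : R} (h : allowed x y z = true) (hx : ∃ k : ℤ, x = k * a)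
    (hy : ∃ k : ℤ, y = k * a) : ∃ k : ℤ, z = k * a := by
  obtain ⟨kx, rfl⟩ := hx
  obtain ⟨ky, rfl⟩ := hy
  rcases (allowed_iff _ _ _).mp h with h | h | h | h
  · exact ⟨-kx - ky, by push_cast; linear_combination h⟩
  · exact ⟨kx + ky, by push_cast; linear_combination -h⟩
  · exact ⟨ky - kx, by push_cast; linear_combination h⟩
  · exact ⟨kx - ky, by push_cast; linear_combination h⟩

/-- **STRUCTURE LEMMA, part 1.** Seed (`c₁ ∈ {0, ±2a₁}`, triad `{a,a,c}`) against attenuator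
(`a₁ ∈ {0, ±2c₁}`, triad `{a,c,c}`): `3·a₁ = 0` or `5·a₁ = 0`. [folklore] -/
theorem three_or_five {c : Fin 9 → R} (h : admissible c = true) : 3 * c 0 = 0 ∨ 5 * c 0 = 0 := by
  rw [admissible_iff] at h
  have h1 := (allowed_iff _ _ _).mp (h (0, 0, 2) (by decide))
  have h2 := (allowed_iff _ _ _).mp (h (0, 2, 2) (by decide))
  dsimp only at h1 h2
  rcases h1 with h1 | h1 | h1 | h1 <;> rcases h2 with h2 | h2 | h2 | h2 <;>
    first
    | (left; linear_combination 2 * h1 - h2) | (right; linear_combination 2 * h1 - h2)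
    | (right; linear_combination 2 * h1 + h2) | (left; linear_combination 2 * h1 + h2)
    | (left; linear_combination 3 * h2) | (left; linear_combination (-6) * h1 + 3 * h2)
    | (left; linear_combination 6 * h1 - 3 * h2)

/-- **STRUCTURE LEMMA, part 2.** Every class of an admissible assignment lies in the cyclic group generated
by the carrier class `c a₁` (chase `b₁, c₁ ← a₁`; `d₁ ← a₁, c₁`; `a₂ ← d₁`; `b₂, c₂ ← a₂`; `d₂ ← a₂, c₂`;
`e₂ ← d₂`). [folklore] -/
theorem span_all {c : Fin 9 → R} (h : admissible c = true) (i : Fin 9) : ∃ k : ℤ, c i = k * c 0 := by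
  rw [admissible_iff] at h
  have h0 : ∃ k : ℤ, c 0 = k * c 0 := ⟨1, by simp⟩
  have h1 : ∃ k : ℤ, c 1 = k * c 0 := span_third (h (0, 0, 1) (by decide)) h0 h0
  have h2 : ∃ k : ℤ, c 2 = k * c 0 := span_third (h (0, 0, 2) (by decide)) h0 h0
  have h3 : ∃ k : ℤ, c 3 = k * c 0 := span_third (h (0, 2, 3) (by decide)) h0 h2
  have h4 : ∃ k : ℤ, c 4 = k * c 0 := span_third (h (3, 3, 4) (by decide)) h3 h3
  have h5 : ∃ k : ℤ, c 5 = k * c 0 := span_third (h (4, 4, 5) (by decide)) h4 h4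
  have h6 : ∃ k : ℤ, c 6 = k * c 0 := span_third (h (4, 4, 6) (by decide)) h4 h4
  have h7 : ∃ k : ℤ, c 7 = k * c 0 := span_third (h (4, 6, 7) (by decide)) h4 h6
  have h8 : ∃ k : ℤ, c 8 = k * c 0 := span_third (h (7, 7, 8) (by decide)) h7 h7
  fin_cases i <;> assumption

omit [DecidableEq R] in
/-- Bézout: if `n` vanishes in `R` with `n` coprime to `15`, then `3a = 0 ∨ 5a = 0` forces `a = 0`. [folklore] -/
theorem class_eq_zero_of_coprime {n : ℕ} (hn : (n : R) = 0) (hcop : Nat.Coprime n 15) {a : R}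
    (h : 3 * a = 0 ∨ 5 * a = 0) : a = 0 := by
  obtain ⟨u, v, huv⟩ := Nat.isCoprime_iff_coprime.mpr hcop
  have hR : (u : R) * n + v * 15 = 1 := by
    have := congrArg (fun z : ℤ => (z : R)) huv; push_cast at this; exact this
  rcases h with h | h
  · linear_combination (-a) * hR + (a * u) * hn + (5 * v) * h
  · linear_combination (-a) * hR + (a * u) * hn + (3 * v) * h

/-- **NO RULE OF ORDER PRIME TO 15.** If some `n` coprime to `15` vanishes in the class ring (class group of
exponent prime to 15), every admissible assignment is the trivial one. [folklore] -/
theorem classes_eq_zero {n : ℕ} (hn : (n : R) = 0) (hcop : Nat.Coprime n 15) {c : Fin 9 → R}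
    (h : admissible c = true) (i : Fin 9) : c i = 0 := by
  obtain ⟨k, hk⟩ := span_all h i
  rw [hk, class_eq_zero_of_coprime hn hcop (three_or_five h), mul_zero]

/-- … hence such a rule kills NO triad at all (designed or not). [folklore] -/
theorem kills_nothing {n : ℕ} (hn : (n : R) = 0) (hcop : Nat.Coprime n 15) {c : Fin 9 → R}
    (h : admissible c = true) (i j l : Fin 9) : allowed (c i) (c j) (c l) = true := by
  rw [classes_eq_zero hn hcop h i, classes_eq_zero hn hcop h j, classes_eq_zero hn hcop h l]; exact allowed_zero

/-- If every triad test agrees between two assignments (possibly over different class rings), so does the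
admissibility test. [folklore] -/
theorem admissible_congr {S : Type*} [CommRing S] [DecidableEq S] {c : Fin 9 → R} {c' : Fin 9 → S}
    (hall : ∀ i j l : Fin 9, allowed (c i) (c j) (c l) = allowed (c' i) (c' j) (c' l)) :
    admissible c = admissible c' := by
  simp only [admissible, hall]

/-- A trivial carrier class makes the whole assignment trivial: nothing is killed. [folklore] -/
theorem trivial_rule {c : Fin 9 → R} (h : admissible c = true) (ha : c 0 = 0) (i j l : Fin 9) :
    allowed (c i) (c j) (c l) = true := by
  have hz : ∀ i, c i = 0 := fun i => by obtain ⟨k, hk⟩ := span_all h i; rw [hk, ha, mul_zero]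
  rw [hz i, hz j, hz l]; exact allowed_zero

omit [DecidableEq R] in
/-- For `p ∈ {3, 5}`, `p·a = 0` and `a ≠ 0`: an integer multiple `m·a` vanishes iff `p ∣ m` (the carrier class has
additive order exactly `p`). [folklore] -/
theorem intCast_mul_eq_zero_iff_dvd {p : ℕ} (hp : p = 3 ∨ p = 5) {a : R} (ha : a ≠ 0) (hpa : (p : R) * a = 0)
    (m : ℤ) : (m : R) * a = 0 ↔ (p : ℤ) ∣ m := by
  constructor
  · intro hm
    obtain ⟨q, r, hqr, hr0, hrp⟩ : ∃ q r : ℤ, m = p * q + r ∧ 0 ≤ r ∧ r < p := by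
      have hp0 : (0 : ℤ) < p := by rcases hp with rfl | rfl <;> decide
      exact ⟨m / p, m % p, (Int.mul_ediv_add_emod m p).symm, Int.emod_nonneg m hp0.ne', Int.emod_lt_of_pos m hp0⟩
    have hra : (r : R) * a = 0 := by
      have e := congrArg (fun z : ℤ => (z : R)) hqr; push_cast at e; rw [e] at hm
      linear_combination hm - (q : R) * hpa
    suffices hr : r = 0 by exact ⟨q, by rw [hqr, hr, add_zero]⟩
    by_contra hr; apply ha
    rcases hp with rfl | rfl <;> push_cast at hra hpa hrp <;> interval_cases r <;> push_cast at hra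
    · exact absurd rfl hr
    · linear_combination hra
    · linear_combination hpa - hra
    · exact absurd rfl hr
    · linear_combination hra
    · linear_combination hpa - 2 * hra
    · linear_combination 2 * hra - hpa
    · linear_combination hpa - hra
  · rintro ⟨q, rfl⟩; push_cast; linear_combination (q : R) * hpa

/-- **TRANSFER.** An admissible assignment with carrier class of order `p ∈ {3,5}` has the same triad tests as
the `ZMod p` assignment `c' i = (exponent of span_all) mod p` (`c' a₁ = 1`), and the same neutral classes.
[folklore] -/
theorem transfer_aux {p : ℕ} (hp : p = 3 ∨ p = 5) {c : Fin 9 → R} (h : admissible c = true)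
    (ha : c 0 ≠ 0) (hpa : (p : R) * c 0 = 0) :
    ∃ c' : Fin 9 → ZMod p, c' 0 = 1 ∧ (∀ i, c i = 0 ↔ c' i = 0) ∧
      ∀ i j l : Fin 9, allowed (c i) (c j) (c l) = allowed (c' i) (c' j) (c' l) := by
  haveI : NeZero p := ⟨by rcases hp with rfl | rfl <;> decide⟩
  choose k hk using span_all h
  have key : ∀ u : ℤ, (u : R) * c 0 = 0 ↔ ((u : ZMod p) = 0) := fun u =>
    (intCast_mul_eq_zero_iff_dvd hp ha hpa u).trans (ZMod.intCast_zmod_eq_zero_iff_dvd u p).symm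
  refine ⟨fun i => (k i : ZMod p), ?_, ?_, ?_⟩
  · have t := (key (k 0 - 1)).mp (by push_cast; linear_combination (-1 : R) * hk 0)
    push_cast at t; exact sub_eq_zero.mp t
  · intro i; rw [hk i]; exact key (k i)
  · intro i j l
    rw [Bool.eq_iff_iff, allowed_iff, allowed_iff, hk i, hk j, hk l]
    have lin : ∀ u v w : ℤ, ((u : R) * c 0 + v * c 0 = w * c 0) ↔ ((u : ZMod p) + v = w) := by
      intro u v w
      have t := key (u + v - w); push_cast at t
      exact ⟨fun hh => sub_eq_zero.mp (t.mp (by linear_combination hh)),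
        fun hh => by linear_combination t.mpr (sub_eq_zero.mpr hh)⟩
    have e1 : ((k i : R) * c 0 + k j * c 0 + k l * c 0 = 0) ↔ ((k i : ZMod p) + k j + k l = 0) := by
      have t := key (k i + k j + k l); push_cast at t
      exact ⟨fun hh => t.mp (by linear_combination hh), fun hh => by linear_combination t.mpr hh⟩
    exact or_congr e1 (or_congr (lin _ _ _) (or_congr (lin _ _ _) (lin _ _ _)))

/-- **EVERY ABELIAN RULE IS A `ℤ/3`- OR A `ℤ/5`-GRADING** (or trivial, `trivial_rule`): a non-trivial admissible
assignment over any class ring kills exactly what some normalised `ZMod 3` or `ZMod 5` assignment kills.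
[folklore] -/
theorem grading {c : Fin 9 → R} (h : admissible c = true) (ha : c 0 ≠ 0) :
    (∃ c' : Fin 9 → ZMod 3, c' 0 = 1 ∧ (∀ i, c i = 0 ↔ c' i = 0) ∧
        ∀ i j l : Fin 9, allowed (c i) (c j) (c l) = allowed (c' i) (c' j) (c' l)) ∨
      (∃ c' : Fin 9 → ZMod 5, c' 0 = 1 ∧ (∀ i, c i = 0 ↔ c' i = 0) ∧
        ∀ i j l : Fin 9, allowed (c i) (c j) (c l) = allowed (c' i) (c' j) (c' l)) := by
  rcases three_or_five h with h3 | h5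
  · exact Or.inl (transfer_aux (Or.inl rfl) h ha (by exact_mod_cast h3))
  · exact Or.inr (transfer_aux (Or.inr rfl) h ha (by exact_mod_cast h5))

/-- All unordered triads `i ≤ j ≤ l` of the nine modes other than the pure cubes (156). [folklore] -/
def triads : List (Fin 9 × Fin 9 × Fin 9) :=
  (List.finRange 9).flatMap fun i => (List.finRange 9).flatMap fun j =>
    (List.finRange 9).filterMap fun l => if i ≤ j ∧ j ≤ l ∧ ¬ (i = j ∧ j = l) then some (i, j, l) else none

/-- The 144 UNDESIGNED triads (bp2's `harm_k53d` universe). [folklore] -/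
def undesigned : List (Fin 9 × Fin 9 × Fin 9) := triads.filter fun t => t ∉ designed

/-- The undesigned triads an assignment KILLS (selection test failed: the coupling vanishes identically, for
all times, whatever the field shapes inside the classes). [folklore] -/
def killed (c : Fin 9 → R) : List (Fin 9 × Fin 9 × Fin 9) :=
  undesigned.filter fun t => !allowed (c t.1) (c t.2.1) (c t.2.2)

end Ring

/-- `ZMod n` with `n` coprime to 15 (`ℤ/2` parities, `ℤ/4` / `ℤ/8` screw-axis phases, `ℤ/7`, `ℤ/16`, …) kills
no triad of the chain. [folklore] -/
theorem zmod_kills_nothing {n : ℕ} (hcop : Nat.Coprime n 15) {c : Fin 9 → ZMod n}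
    (h : admissible c = true) (i j l : Fin 9) : allowed (c i) (c j) (c l) = true :=
  kills_nothing (ZMod.natCast_self n) hcop h i j l

/-- **PARITY KILLS NOTHING.** Any product of `ℤ/2`'s (parity vectors `k mod 2`, `±1` characters of order-two
isometries, both together) kills no triad of the chain: the designed squares `a² → b, a² → c, c² → a, c² → b,
d² → a′` force all nine modes into the even class. [folklore] -/
theorem parity_kills_nothing {ι : Type*} [DecidableEq ι] [Fintype ι] {c : Fin 9 → ι → ZMod 2}
    (h : admissible c = true) (i j l : Fin 9) : allowed (c i) (c j) (c l) = true :=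
  kills_nothing (n := 2) (by funext x; exact ZMod.natCast_self 2) (by decide) h i j l

section Witnesses

/-- 156 triads. [folklore] -/
theorem triads_length : triads.length = 156 := by decide +kernel

/-- 144 of them undesigned (so exactly the 12 designed ones are in the universe). [folklore] -/
theorem undesigned_length : undesigned.length = 144 := by decide +kernel

/-- The record's optimal `ℤ/5` pattern `a₁=1 b₁=0 c₁=2 d₁=1 a₂=2 b₂=0 c₂=1 d₂=1 e₂=0` (e.g. `k_x mod 5` on an
index-5 sublattice family). [folklore] -/
def z5opt : Fin 9 → ZMod 5 := ![1, 0, 2, 1, 2, 0, 1, 1, 0]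

/-- It is admissible … [folklore] -/
theorem z5opt_admissible : admissible z5opt = true := by decide +kernel

/-- … and kills 78 of the 144 undesigned triads (the record's maximum over all abelian rules). [folklore] -/
theorem z5opt_killed : (killed z5opt).length = 78 := by decide +kernel

/-- The `ℤ/3` pattern 'gate 1 off the sublattice, gate 2 on it': `a₁=b₁=c₁=d₁=1`, gate 2 neutral. [folklore] -/
def z3cross : Fin 9 → ZMod 3 := ![1, 1, 1, 1, 0, 0, 0, 0, 0]

/-- It is admissible … [folklore] -/
theorem z3cross_admissible : admissible z3cross = true := by decide +kernel

/-- … kills 60 undesigned triads … [folklore] -/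
theorem z3cross_killed : (killed z3cross).length = 60 := by decide +kernel

/-- … namely exactly the undesigned triads with exactly ONE gate-1 member (every `{x₁, y₂, z₂}` cross triad
dies; no in-gate triad and no `{x₁, y₁, z₂}` triad does). [folklore] -/
theorem z3cross_killed_iff (t : Fin 9 × Fin 9 × Fin 9) :
    t ∈ killed z3cross ↔ t ∈ undesigned ∧
      ((if t.1 < 4 then 1 else 0) + (if t.2.1 < 4 then 1 else 0) + (if t.2.2 < 4 then 1 else 0) : ℕ) = 1 := by
  revert t
  decide +kernel

/-- A LADDER-REUSABLE `ℤ/5` pattern (each gate-2 class twice the gate-1 class, as for a self-similar chain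
whose wavevectors double per stage): `1 0 2 1 | 2 0 4 2 | 1`. [folklore] -/
def z5ladder : Fin 9 → ZMod 5 := ![1, 0, 2, 1, 2, 0, 4, 2, 1]

/-- It is admissible … [folklore] -/
theorem z5ladder_admissible : admissible z5ladder = true := by decide +kernel

/-- … and kills 68 undesigned triads (the record's maximum among ladder-reusable rules). [folklore] -/
theorem z5ladder_killed : (killed z5ladder).length = 68 := by decide +kernel

end Witnesses

section Priority

/-- **bp3's gate-internal binders die under EVERY non-trivial `ℤ/5` rule** (STATUS l.1805: P0 `{a,b,c}`,
P1 `{b,b,c}`, P2 `{a,b,b}`): the gate's designed triads force clock neutral, trigger `= ±2 ×` carrier. [folklore] -/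
theorem gate_binders_killed_z5 : ∀ a b c : ZMod 5, a ≠ 0 → allowed a a b = true → allowed a a c = true →
    allowed a c c = true → allowed b c c = true →
    allowed a b c = false ∧ allowed b b c = false ∧ allowed a b b = false := by
  decide

/-- … while NO `ℤ/3` rule kills P0 `{a,b,c}`. [folklore] -/
theorem gate_binder_allowed_z3 : ∀ a b c : ZMod 3, allowed a a b = true → allowed a a c = true →
    allowed a c c = true → allowed b c c = true → allowed a b c = true := by
  decide

/-- **The hand-over leak `{a₁,a₂,c₂}` (carrier₁ × carrier₂ → trigger₂) dies under a `ℤ/5` rule iff gate 2 is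
neutral** (`a₂ = 0`; then all of gate 2 is, chasing spans from `a₂`). [folklore] -/
theorem handover_killed_iff_z5 : ∀ a a' c' : ZMod 5, a ≠ 0 → allowed a' a' c' = true →
    allowed a' c' c' = true → (allowed a a' c' = false ↔ a' = 0) := by
  decide

/-- … and under a `ℤ/3` rule likewise iff gate 2 is neutral. [folklore] -/
theorem handover_killed_iff_z3 : ∀ a a' c' : ZMod 3, a ≠ 0 → allowed a' a' c' = true →
    allowed a' c' c' = true → (allowed a a' c' = false ↔ a' = 0) := by
  decide

/-- Under every `ℤ/5` rule the gate-2 clock class `b₂` is neutral (fed by `a₂²` and `c₂²` with `c₂ = ±2a₂`).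
[folklore] -/
theorem b2_neutral_z5 : ∀ a' b' c' : ZMod 5, allowed a' a' b' = true → allowed a' a' c' = true →
    allowed a' c' c' = true → allowed b' c' c' = true → b' = 0 := by
  decide

/-- **IMMORTAL TRIADS, `ℤ/5`.** `{x,x,b₂}` is allowed for every class `x` under every `ℤ/5` rule. [folklore] -/
theorem immortal_z5 {c : Fin 9 → ZMod 5} (h : admissible c = true) (i : Fin 9) :
    allowed (c i) (c i) (c 5) = true := by
  rw [admissible_iff] at h
  rw [b2_neutral_z5 (c 4) (c 5) (c 6) (h (4, 4, 5) (by decide)) (h (4, 4, 6) (by decide))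
    (h (4, 6, 6) (by decide)) (h (5, 6, 6) (by decide)), allowed_iff]
  exact Or.inr (Or.inr (Or.inl (add_zero _)))

/-- The `ℤ/3` chase behind `immortal_z3`: six classes, all designed triads among them. [folklore] -/
theorem immortal_z3_aux : ∀ a c d a' b' c' : ZMod 3, allowed a a c = true → allowed a c c = true →
    allowed a c d = true → allowed d d a' = true → allowed a' a' b' = true → allowed a' a' c' = true →
    allowed a' c' c' = true → allowed b' c' c' = true →
    allowed a a b' = true ∧ allowed c c b' = true ∧ allowed d d b' = true := by
  decide

/-- **IMMORTAL TRIADS, `ℤ/3`.** `{a₁,a₁,b₂}`, `{c₁,c₁,b₂}`, `{d₁,d₁,b₂}` are allowed under every `ℤ/3` rule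
(`{x,x,y}` dies only for `x` neutral and `y` charged; a neutral `a₁`, `c₁` or `d₁` neutralises `b₂`). [folklore] -/
theorem immortal_z3 {c : Fin 9 → ZMod 3} (h : admissible c = true) :
    allowed (c 0) (c 0) (c 5) = true ∧ allowed (c 2) (c 2) (c 5) = true ∧
      allowed (c 3) (c 3) (c 5) = true := by
  rw [admissible_iff] at h
  exact immortal_z3_aux (c 0) (c 2) (c 3) (c 4) (c 5) (c 6) (h (0, 0, 2) (by decide))
    (h (0, 2, 2) (by decide)) (h (0, 2, 3) (by decide)) (h (3, 3, 4) (by decide)) (h (4, 4, 5) (by decide))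
    (h (4, 4, 6) (by decide)) (h (4, 6, 6) (by decide)) (h (5, 6, 6) (by decide))

/-- **IMMORTAL UNDER EVERY ABELIAN RULE.** Over any class ring, `{a₁,a₁,b₂}`, `{c₁,c₁,b₂}`, `{d₁,d₁,b₂}`
pass the test of every admissible assignment (record §4: the 3 immortal triads of 144). [folklore] -/
theorem immortal {R : Type*} [CommRing R] [DecidableEq R] {c : Fin 9 → R} (h : admissible c = true) :
    allowed (c 0) (c 0) (c 5) = true ∧ allowed (c 2) (c 2) (c 5) = true ∧
      allowed (c 3) (c 3) (c 5) = true := by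
  by_cases ha : c 0 = 0
  · exact ⟨trivial_rule h ha _ _ _, trivial_rule h ha _ _ _, trivial_rule h ha _ _ _⟩
  · rcases grading h ha with ⟨c', -, -, hall⟩ | ⟨c', -, -, hall⟩ <;>
      have h' : admissible c' = true := (admissible_congr hall) ▸ h
    · obtain ⟨x, y, z⟩ := immortal_z3 h'
      exact ⟨(hall _ _ _).trans x, (hall _ _ _).trans y, (hall _ _ _).trans z⟩
    · exact ⟨(hall _ _ _).trans (immortal_z5 h' 0), (hall _ _ _).trans (immortal_z5 h' 2),
        (hall _ _ _).trans (immortal_z5 h' 3)⟩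

/-- **GATE-INTERNAL BINDERS DIE UNDER EVERY RULE THAT IS NOT A `ℤ/3`-GRADING**: over any class ring, carrier
class not 3-torsion ⇒ bp3's P0 `{a₁,b₁,c₁}`, P1 `{b₁,b₁,c₁}`, P2 `{a₁,b₁,b₁}` are killed (record §7). [folklore] -/
theorem gate_binders_killed {R : Type*} [CommRing R] [DecidableEq R] {c : Fin 9 → R}
    (h : admissible c = true) (h3 : 3 * c 0 ≠ 0) :
    allowed (c 0) (c 1) (c 2) = false ∧ allowed (c 1) (c 1) (c 2) = false ∧
      allowed (c 0) (c 1) (c 1) = false := by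
  have ha : c 0 ≠ 0 := fun h0 => h3 (by rw [h0, mul_zero])
  obtain ⟨c', h1, -, hall⟩ :=
    transfer_aux (Or.inr rfl) h ha (by exact_mod_cast (three_or_five h).resolve_left h3)
  have h' := (admissible_iff c').mp ((admissible_congr hall) ▸ h)
  obtain ⟨x, y, z⟩ := gate_binders_killed_z5 (c' 0) (c' 1) (c' 2) (by rw [h1]; decide)
    (h' (0, 0, 1) (by decide)) (h' (0, 0, 2) (by decide)) (h' (0, 2, 2) (by decide)) (h' (1, 2, 2) (by decide))
  exact ⟨(hall _ _ _).trans x, (hall _ _ _).trans y, (hall _ _ _).trans z⟩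

/-- **THE HAND-OVER LEAK DIES IFF GATE 2 IS NEUTRAL**, under every non-trivial abelian rule: `{a₁,a₂,c₂}` is
killed iff `c a₂ = 0` (and then all of gate 2 is neutral and its own binder `{a₂,b₂,c₂}` allowed). [folklore] -/
theorem handover_killed_iff {R : Type*} [CommRing R] [DecidableEq R] {c : Fin 9 → R}
    (h : admissible c = true) (ha : c 0 ≠ 0) : allowed (c 0) (c 4) (c 6) = false ↔ c 4 = 0 := by
  rcases grading h ha with ⟨c', h1, hzero, hall⟩ | ⟨c', h1, hzero, hall⟩ <;>
    have h' := (admissible_iff c').mp ((admissible_congr hall) ▸ h) <;> rw [hall, hzero]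
  · exact handover_killed_iff_z3 (c' 0) (c' 4) (c' 6) (by rw [h1]; decide) (h' (4, 4, 6) (by decide))
      (h' (4, 6, 6) (by decide))
  · exact handover_killed_iff_z5 (c' 0) (c' 4) (c' 6) (by rw [h1]; decide) (h' (4, 4, 6) (by decide))
      (h' (4, 6, 6) (by decide))

end Priority

end Summit.NavierStokesRegularity.FluidComputer.ChainSelectionRules
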